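import Mathlib.GroupTheory.GroupAction.Quotient
import Mathlib.GroupTheory.FreeGroup.Reduce
import Mathlib.Logic.Equiv.Fintype
import Mathlib.Data.List.Infix
import Literature.GroupTheory.CombinatorialGroupTheory.FreeGroupoidTreeBasis
import HarnessLib

/-!
# M. Hall's completion of a coset graph (free-factor form of Hall's theorem, part 1)

Topic `Literature/GroupTheory/CombinatorialGroupTheory`; companion of `FreeGroupSubgroupSeparable.lean`
(which proves M. Hall's theorem WITHOUT its free-factor clause) and `FreeGroupoidTreeBasis.lean`.
Setting of Lyndon–Schupp, *Combinatorial Group Theory*, Ch. I, proof of Prop. 3.10 (Burns' form of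
M. Hall 1949): `G` a free group (Mathlib `IsFreeGroup G`, letters `IsFreeGroup.Generators G`), `S ⊆ G`
finite, `H = ⟨S⟩`, `Q = G/H` with base point `x₀ = H`.

* `X S` — the finite set of cosets `s·x₀` for the terminal segments `s` of the words of the elements of
  `S` ("let `T` consist of all initial segments of elements of `T₂`", loc. cit.), `V S` its type of points;
* `σ S a` — a permutation of `V S` extending the partial translation by the letter `a` ("we may extend
  `ρ(x)` to a permutation `π(x)` of `T`"), `ρ S = IsFreeGroup.lift (σ S)` the completed action, with which
  `V S` is made a `G`-set; `Cov S` — its action groupoid (Mathlib `ActionCategory`, a free groupoid by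
  Mathlib's `actionGroupoidIsFree`: the finite covering graph of the bouquet);
* `IsTrue` — the generating arrows of `Cov S` that are genuine edges of the coset graph of `H`;
  every point is reachable from the base point through true arrows (`reachable`), whence a spanning
  arborescence `tree S` of `Cov S` consisting of true arrows (`arb`, `isTrue_of_mem_tree`), built by
  breadth-first search (`height`, `parent`);
The labels of tree paths and the closed paths spelled by words are in `FreeFactorWordPaths.lean`; the
free-factor theorem itself is assembled in `FreeFactorFiniteIndex.lean`.  Classical (Hall 1949,
Burns 1969, Stallings 1983); no new mathematics. [cite: LyndonSchupp2001, Ch. I Prop. 3.10]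
-/

namespace Literature.GroupTheory.CombinatorialGroupTheory

namespace FreeFactor

open CategoryTheory Quiver IsFreeGroupoid FreeGroupoidTree Equiv

universe u

noncomputable section

open scoped Classical

/- As in Mathlib's `NielsenSchreier.lean`: the objects of the action groupoid, of its generating quiver
(`IsFreeGroupoid.Generators`), of the symmetrised quiver (`Quiver.Symmetrify`) and of a wide subquiver
(`WideSubquiver.toType`) are all the same type only up to unfolding type synonyms, so unification must be
allowed to unfold them. -/
set_option backward.isDefEq.respectTransparency false

variable {G : Type u} [Group G] [IsFreeGroup G]

/-! ## Words in the chosen free basis -/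

/-- The letters: Mathlib's chosen free basis `IsFreeGroup.Generators G` of the free group `G`.
[cite: LyndonSchupp2001, Ch. I Prop. 3.10] -/
abbrev Letter (G : Type u) [Group G] [IsFreeGroup G] : Type u := IsFreeGroup.Generators G

/-- The element of `G` spelled by a word in the letters and their inverses.
[cite: LyndonSchupp2001, Ch. I Prop. 3.10] -/
def wordProd (L : List (Letter G × Bool)) : G :=
  (IsFreeGroup.toFreeGroup G).symm (FreeGroup.mk L)

/-- The reduced word of an element of `G`. [cite: LyndonSchupp2001, Ch. I Prop. 3.10] -/
def word (g : G) : List (Letter G × Bool) :=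
  (IsFreeGroup.toFreeGroup G g).toWord

omit [Group G] [IsFreeGroup G] in
/-- An element is the product of its reduced word. [cite: LyndonSchupp2001, Ch. I Prop. 3.10] -/
theorem wordProd_word [Group G] [IsFreeGroup G] (g : G) : wordProd (word g) = g := by
  simp [wordProd, word, FreeGroup.mk_toWord]

/-- The empty word spells `1`. [cite: LyndonSchupp2001, Ch. I Prop. 3.10] -/
theorem wordProd_nil : wordProd ([] : List (Letter G × Bool)) = 1 := by
  simp [wordProd, ← FreeGroup.one_eq_mk]

/-- The generator `a`, through the identification `G ≃ FreeGroup (Letter G)`.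
[cite: LyndonSchupp2001, Ch. I Prop. 3.10] -/
theorem toFreeGroup_symm_of (a : Letter G) :
    (IsFreeGroup.toFreeGroup G).symm (FreeGroup.of a) = IsFreeGroup.of a := rfl

/-- A positive letter in front multiplies by the generator. [cite: LyndonSchupp2001, Ch. I Prop. 3.10] -/
theorem wordProd_cons_true (a : Letter G) (L : List (Letter G × Bool)) :
    wordProd ((a, true) :: L) = IsFreeGroup.of a * wordProd L := by
  have h : FreeGroup.mk ((a, true) :: L) = FreeGroup.of a * FreeGroup.mk L := rfl
  rw [wordProd, h, map_mul, toFreeGroup_symm_of]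
  rfl

/-- A negative letter in front multiplies by the inverse generator.
[cite: LyndonSchupp2001, Ch. I Prop. 3.10] -/
theorem wordProd_cons_false (a : Letter G) (L : List (Letter G × Bool)) :
    wordProd ((a, false) :: L) = (IsFreeGroup.of a)⁻¹ * wordProd L := by
  have h : FreeGroup.mk ((a, false) :: L) = (FreeGroup.of a)⁻¹ * FreeGroup.mk L := rfl
  rw [wordProd, h, map_mul, map_inv, toFreeGroup_symm_of]
  rfl

/-! ## The finite set of cosets and the completed action -/

variable (S : Finset G)

/-- `H = ⟨S⟩`. [cite: LyndonSchupp2001, Ch. I Prop. 3.10] -/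
abbrev Hgen : Subgroup G := Subgroup.closure (S : Set G)

/-- The coset space `Q = G/H`. [cite: LyndonSchupp2001, Ch. I Prop. 3.10] -/
abbrev Q : Type u := G ⧸ Hgen S

/-- The base point `x₀ = H` of `G/H`. [cite: LyndonSchupp2001, Ch. I Prop. 3.10] -/
def x₀ : Q S := ((1 : G) : Q S)

omit [IsFreeGroup G] in
/-- The stabiliser of the base point is `H`. [cite: LyndonSchupp2001, Ch. I Prop. 3.10] -/
theorem smul_x₀_eq_iff (g : G) : g • x₀ S = x₀ S ↔ g ∈ Hgen S := by
  rw [← MulAction.mem_stabilizer_iff, x₀, MulAction.stabilizer_quotient]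

/-- The finite set `X` of cosets visited while reading the words of the generators from the right,
together with the base point ("all initial segments of elements of `T₂`").
[cite: LyndonSchupp2001, Ch. I Prop. 3.10] -/
def X : Set (Q S) :=
  insert (x₀ S) (⋃ w ∈ (S : Set G), (fun s => wordProd s • x₀ S) '' {s | s <:+ word w})

/-- `X` is finite. [cite: LyndonSchupp2001, Ch. I Prop. 3.10] -/
theorem X_finite : (X S).Finite := by
  refine Set.Finite.insert _ (Set.Finite.biUnion S.finite_toSet fun L _ => ?_)
  exact ((List.finite_toSet (word L).tails).subset fun s hs => (List.mem_tails s _).2 hs).image _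

/-- The base point lies in `X`. [cite: LyndonSchupp2001, Ch. I Prop. 3.10] -/
theorem x₀_mem : x₀ S ∈ X S := Set.mem_insert _ _

/-- Every terminal segment of the word of a generator carries the base point into `X`.
[cite: LyndonSchupp2001, Ch. I Prop. 3.10] -/
theorem suffix_mem {w : G} (hw : w ∈ S) {s : List (Letter G × Bool)} (hs : s <:+ word w) :
    wordProd s • x₀ S ∈ X S :=
  Set.mem_insert_of_mem _ (Set.mem_biUnion (Finset.mem_coe.2 hw) ⟨s, hs, rfl⟩)

/-- The type of points of `X`. [cite: LyndonSchupp2001, Ch. I Prop. 3.10] -/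
def V : Type u := ↥(X S)

/-- `X` is finite, so its type of points is. [cite: LyndonSchupp2001, Ch. I Prop. 3.10] -/
instance : Finite (V S) := (X_finite S).to_subtype

/-- The base vertex. [cite: LyndonSchupp2001, Ch. I Prop. 3.10] -/
def v₀ : V S := ⟨x₀ S, x₀_mem S⟩

/-- The vertex with a given coset in `X`. [cite: LyndonSchupp2001, Ch. I Prop. 3.10] -/
def mkV (x : Q S) (hx : x ∈ X S) : V S := ⟨x, hx⟩

/-- The coset of `mkV x`. [cite: LyndonSchupp2001, Ch. I Prop. 3.10] -/
@[simp] theorem mkV_val (x : Q S) (hx : x ∈ X S) : (mkV S x hx).1 = x := rfl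

/-- Two vertices with the same coset are equal. [cite: LyndonSchupp2001, Ch. I Prop. 3.10] -/
theorem V.ext {u v : V S} (h : u.1 = v.1) : u = v := Subtype.ext h

/-- The coset of the base vertex is the base point. [cite: LyndonSchupp2001, Ch. I Prop. 3.10] -/
@[simp] theorem v₀_val : (v₀ S).1 = x₀ S := rfl

/-- Each letter's partial translation of `X` extends to a permutation of `X` ("we may extend `ρ(x)` to a
permutation `π(x)` of `T`"). [cite: LyndonSchupp2001, Ch. I Prop. 3.10] -/
theorem exists_perm (a : Letter G) :
    ∃ σ : Perm (V S), ∀ (u : V S) (hu : IsFreeGroup.of a • u.1 ∈ X S), σ u = mkV S _ hu := by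
  obtain ⟨σ, hσ⟩ := Perm.exists_extending_pair
    (fun u : {u : V S // IsFreeGroup.of a • u.1 ∈ X S} => (u : V S))
    (fun u => mkV S (IsFreeGroup.of a • u.1.1) u.2)
    Subtype.val_injective
    (fun u v h => Subtype.ext (V.ext S (MulAction.injective (IsFreeGroup.of a)
      (congrArg Subtype.val h))))
  exact ⟨σ, fun u hu => hσ ⟨u, hu⟩⟩

/-- The chosen permutation extending the letter `a`. [cite: LyndonSchupp2001, Ch. I Prop. 3.10] -/
def σ (a : Letter G) : Perm (V S) := (exists_perm S a).choose

/-- `σ a` agrees with the translation by `a` wherever this stays inside `X`.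
[cite: LyndonSchupp2001, Ch. I Prop. 3.10] -/
theorem σ_apply (a : Letter G) (u : V S) (hu : IsFreeGroup.of a • u.1 ∈ X S) :
    σ S a u = mkV S _ hu :=
  (exists_perm S a).choose_spec u hu

/-- `σ a` carries `a⁻¹·u` to `u` whenever both lie in `X`. [cite: LyndonSchupp2001, Ch. I Prop. 3.10] -/
theorem σ_apply_inv_smul (a : Letter G) (u : V S) (hu : (IsFreeGroup.of a)⁻¹ • u.1 ∈ X S) :
    σ S a (mkV S _ hu) = u := by
  have h : IsFreeGroup.of a • (mkV S _ hu).1 ∈ X S := by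
    rw [mkV_val, smul_inv_smul]; exact u.2
  rw [σ_apply S a _ h]
  exact V.ext S (by rw [mkV_val, mkV_val, smul_inv_smul])

/-- The completed action `ρ = lift σ : G → Perm X`. [cite: LyndonSchupp2001, Ch. I Prop. 3.10] -/
def ρ : G →* Perm (V S) := IsFreeGroup.lift (σ S)

/-- The completed action of a letter is its chosen permutation. [cite: LyndonSchupp2001, Ch. I Prop. 3.10] -/
@[simp] theorem ρ_of (a : Letter G) : ρ S (IsFreeGroup.of a) = σ S a := IsFreeGroup.lift_of _ _

/-- `X` as a `G`-set through the completed action `ρ` ("this defines an action `π` of `F` on `T`").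
[cite: LyndonSchupp2001, Ch. I Prop. 3.10] -/
instance : MulAction G (V S) := MulAction.compHom (V S) (ρ S)

/-- The action is `ρ`. [cite: LyndonSchupp2001, Ch. I Prop. 3.10] -/
theorem smul_def (g : G) (u : V S) : g • u = ρ S g u := rfl

/-- A letter acts by its chosen permutation. [cite: LyndonSchupp2001, Ch. I Prop. 3.10] -/
theorem of_smul (a : Letter G) (u : V S) : IsFreeGroup.of a • u = σ S a u := by
  rw [smul_def, ρ_of]

/-! ## The covering groupoid and its true arrows -/

/-- The action groupoid of the completed action: a finite covering graph of the bouquet of circles on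
the letters (Mathlib `ActionCategory`). [cite: LyndonSchupp2001, Ch. I Prop. 3.10] -/
def Cov : Type u := ActionCategory G (V S)

/-- The action groupoid structure (Mathlib). [cite: LyndonSchupp2001, Ch. I Prop. 3.10] -/
instance : Groupoid (Cov S) := CategoryTheory.ActionCategory.instGroupoid

/-- The action groupoid of a free group is a free groupoid (Mathlib `actionGroupoidIsFree`: "a covering
of a graph is a graph"). [cite: LyndonSchupp2001, Ch. I Prop. 3.10] -/
instance : IsFreeGroupoid (Cov S) := IsFreeGroupoid.actionGroupoidIsFree

/-- The object of `Cov S` at a vertex. [cite: LyndonSchupp2001, Ch. I Prop. 3.10] -/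
def vtx (u : V S) : Cov S := ⟨(), u⟩

/-- The vertex of the object at `u` is `u`. [cite: LyndonSchupp2001, Ch. I Prop. 3.10] -/
@[simp] theorem back_vtx (u : V S) : ActionCategory.back (vtx S u) = u := rfl

/-- Every object is the object at its vertex. [cite: LyndonSchupp2001, Ch. I Prop. 3.10] -/
theorem vtx_back (a : Cov S) : vtx S (ActionCategory.back a) = a := rfl

/-- Values of composites in `Cov S`. [cite: LyndonSchupp2001, Ch. I Prop. 3.10] -/
theorem comp_val {a b c : Cov S} (f : a ⟶ b) (g : b ⟶ c) : (f ≫ g).val = g.val * f.val := rfl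

/-- The base object. [cite: LyndonSchupp2001, Ch. I Prop. 3.10] -/
def r : Cov S := vtx S (v₀ S)

/-- In `Cov S` the value of a composite is the product of the values (reversed), of an identity is `1`,
and of an inverse is the inverse. [cite: LyndonSchupp2001, Ch. I Prop. 3.10] -/
theorem inv_val {a b : Cov S} (f : a ⟶ b) : (CategoryTheory.inv f).val = f.val⁻¹ := by
  rw [← Groupoid.inv_eq_inv]; rfl

/-- A generating arrow `e : a ⟶ b` of `Cov S` (a letter with `σ`-translate `b` of `a`) is TRUE when it is
a genuine edge of the coset graph of `H`: the letter translates the coset of `a` to the coset of `b`.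
[cite: LyndonSchupp2001, Ch. I Prop. 3.10] -/
def IsTrue ⦃a b : Generators (Cov S)⦄ (e : a ⟶ b) : Prop :=
  IsFreeGroup.of e.1 • (ActionCategory.back a : V S).1 = (ActionCategory.back b : V S).1

/-- A true step between two vertices: some letter translates one coset to the other (in either
direction). [cite: LyndonSchupp2001, Ch. I Prop. 3.10] -/
def TrueStep (u v : V S) : Prop :=
  ∃ a : Letter G, IsFreeGroup.of a • u.1 = v.1 ∨ IsFreeGroup.of a • v.1 = u.1

/-- A true step is realised by a true arrow of the symmetrised generating quiver of `Cov S`.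
[cite: LyndonSchupp2001, Ch. I Prop. 3.10] -/
theorem exists_trueArrow {u v : V S} (h : TrueStep S u v) :
    ∃ f : (show Symmetrify (Generators (Cov S)) from vtx S u) ⟶ (show Symmetrify (Generators (Cov S))
      from vtx S v), SymmArrowSat (IsTrue S) f := by
  obtain ⟨a, h | h⟩ := h
  · have hmem : IsFreeGroup.of a • u.1 ∈ X S := by rw [h]; exact v.2
    have hstep : IsFreeGroup.of a • u = v := by
      rw [of_smul, σ_apply S a u hmem]; exact V.ext S h
    exact ⟨Sum.inl ⟨a, hstep⟩, h⟩
  · have hmem : IsFreeGroup.of a • v.1 ∈ X S := by rw [h]; exact u.2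
    have hstep : IsFreeGroup.of a • v = u := by
      rw [of_smul, σ_apply S a v hmem]; exact V.ext S h
    exact ⟨Sum.inr ⟨a, hstep⟩, h⟩

/-- `ReachIn n v`: `v` is reached from the base vertex by `n` true steps.
[cite: LyndonSchupp2001, Ch. I Prop. 3.10] -/
def ReachIn : ℕ → V S → Prop
  | 0, v => v = v₀ S
  | n + 1, v => ∃ u, ReachIn n u ∧ TrueStep S u v

/-- Reading a word whose terminal segments stay in `X` reaches its coset by true steps.
[cite: LyndonSchupp2001, Ch. I Prop. 3.10] -/
theorem reachIn_word : ∀ (L : List (Letter G × Bool))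
    (hL : ∀ s, s <:+ L → wordProd s • x₀ S ∈ X S),
    ReachIn S L.length (mkV S (wordProd L • x₀ S) (hL L (List.suffix_refl L)))
  | [], hL => by
    change mkV S (wordProd [] • x₀ S) _ = v₀ S
    exact V.ext S (by rw [mkV_val, v₀_val, wordProd_nil, one_smul])
  | (a, b) :: L, hL => by
    have hL' : ∀ s, s <:+ L → wordProd s • x₀ S ∈ X S :=
      fun s hs => hL s (hs.trans (List.suffix_cons _ _))
    refine ⟨mkV S (wordProd L • x₀ S) (hL' L (List.suffix_refl L)), reachIn_word L hL', a, ?_⟩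
    cases b with
    | true =>
      left
      rw [mkV_val, mkV_val, wordProd_cons_true, mul_smul]
    | false =>
      right
      rw [mkV_val, mkV_val, wordProd_cons_false, mul_smul, smul_inv_smul]

/-- Every vertex is reachable from the base vertex by true steps.
[cite: LyndonSchupp2001, Ch. I Prop. 3.10] -/
theorem reachable (v : V S) : ∃ n, ReachIn S n v := by
  obtain ⟨x, hx⟩ := v
  rcases (Set.mem_insert_iff.1 hx) with h | h
  · exact ⟨0, V.ext S h⟩
  · obtain ⟨w, hw, s, hs, hsx⟩ : ∃ w ∈ (S : Set G), ∃ s, s <:+ word w ∧ wordProd s • x₀ S = x := by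
      simpa only [Set.mem_iUnion, Set.mem_image, Set.mem_setOf_eq, exists_prop] using h
    refine ⟨s.length, ?_⟩
    have key := reachIn_word S s fun t ht => suffix_mem S hw (ht.trans hs)
    have heq : mkV S (wordProd s • x₀ S) (suffix_mem S hw hs) = ⟨x, hx⟩ := V.ext S hsx
    rw [← heq]
    exact key

/-- The breadth-first height of a vertex: the least number of true steps from the base vertex.
[cite: LyndonSchupp2001, Ch. I Prop. 3.10] -/
def height (v : V S) : ℕ := Nat.find (reachable S v)

/-- A vertex is reached in `height v` true steps. [cite: LyndonSchupp2001, Ch. I Prop. 3.10] -/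
theorem reachIn_height (v : V S) : ReachIn S (height S v) v := Nat.find_spec (reachable S v)

/-- The height is the least number of true steps. [cite: LyndonSchupp2001, Ch. I Prop. 3.10] -/
theorem height_le {v : V S} {n : ℕ} (h : ReachIn S n v) : height S v ≤ n := Nat.find_le h

/-- The base vertex has height `0`. [cite: LyndonSchupp2001, Ch. I Prop. 3.10] -/
theorem height_v₀ : height S (v₀ S) = 0 :=
  Nat.eq_zero_of_le_zero (height_le S (show ReachIn S 0 (v₀ S) from rfl))

/-- A vertex other than the base vertex has a parent: a vertex one level lower joined to it by a true
step. [cite: LyndonSchupp2001, Ch. I Prop. 3.10] -/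
theorem exists_parent (v : V S) (hv : v ≠ v₀ S) :
    ∃ u : V S, TrueStep S u v ∧ height S u + 1 = height S v := by
  obtain ⟨n, hn⟩ : ∃ n, height S v = n + 1 := by
    rcases h : height S v with _ | n
    · exact absurd (by simpa [h, ReachIn] using reachIn_height S v) hv
    · exact ⟨n, rfl⟩
  have hr := reachIn_height S v
  rw [hn] at hr
  obtain ⟨u, hu, hstep⟩ := hr
  refine ⟨u, hstep, ?_⟩
  have h1 : height S u ≤ n := height_le S hu
  have h2 : n ≤ height S u := by
    by_contra hlt
    have h3 : ReachIn S (height S u + 1) v := ⟨u, reachIn_height S u, hstep⟩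
    have h4 := height_le S h3
    omega
  omega

/-- The parent of a non-base vertex. [cite: LyndonSchupp2001, Ch. I Prop. 3.10] -/
def parent (v : V S) (hv : v ≠ v₀ S) : V S := (exists_parent S v hv).choose

/-- The parent is joined to the vertex by a true step. [cite: LyndonSchupp2001, Ch. I Prop. 3.10] -/
theorem parent_step (v : V S) (hv : v ≠ v₀ S) : TrueStep S (parent S v hv) v :=
  (exists_parent S v hv).choose_spec.1

/-- The parent is one level lower. [cite: LyndonSchupp2001, Ch. I Prop. 3.10] -/
theorem height_parent (v : V S) (hv : v ≠ v₀ S) : height S (parent S v hv) + 1 = height S v :=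
  (exists_parent S v hv).choose_spec.2

/-- The tree arrow into a non-base vertex: a true arrow of the symmetrised generating quiver from its
parent. [cite: LyndonSchupp2001, Ch. I Prop. 3.10] -/
def parentArrow (v : V S) (hv : v ≠ v₀ S) :
    (show Symmetrify (Generators (Cov S)) from vtx S (parent S v hv)) ⟶
      (show Symmetrify (Generators (Cov S)) from vtx S v) :=
  (exists_trueArrow S (parent_step S v hv)).choose

/-- The parent arrow is true. [cite: LyndonSchupp2001, Ch. I Prop. 3.10] -/
theorem parentArrow_true (v : V S) (hv : v ≠ v₀ S) : SymmArrowSat (IsTrue S) (parentArrow S v hv) :=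
  (exists_trueArrow S (parent_step S v hv)).choose_spec

/-- The breadth-first spanning tree: the wide subquiver of the symmetrised generating quiver of `Cov S`
consisting of the parent arrows. [cite: LyndonSchupp2001, Ch. I Prop. 3.10] -/
def tree : WideSubquiver (Symmetrify (Generators (Cov S))) := fun a b =>
  {f | ∃ hb : (ActionCategory.back b : V S) ≠ v₀ S,
    (⟨a, f⟩ : Σ a' : Symmetrify (Generators (Cov S)), (a' ⟶ b)) =
      ⟨vtx S (parent S (ActionCategory.back b) hb), parentArrow S (ActionCategory.back b) hb⟩}

/-- The parent arrows form an arborescence rooted at the base object (heights strictly increase along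
tree arrows, every non-base vertex has exactly one incoming tree arrow).
[cite: LyndonSchupp2001, Ch. I Prop. 3.10] -/
instance arb : Arborescence (tree S) :=
  arborescenceMk (r S) (fun a => height S (ActionCategory.back a : V S))
    (by
      rintro a b ⟨f, hb, hf⟩
      have ha : a = vtx S (parent S (ActionCategory.back b) hb) := congrArg Sigma.fst hf
      rw [ha, back_vtx, ← height_parent S _ hb]
      exact Nat.lt_succ_self _)
    (by
      rintro a b c ⟨e, hc, he⟩ ⟨f, hc', hf⟩
      have h := he.trans hf.symm
      obtain ⟨rfl, h2⟩ := Sigma.mk.inj_iff.1 h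
      exact ⟨rfl, heq_of_eq (Subtype.ext (eq_of_heq h2))⟩)
    (by
      intro b
      by_cases hb : (ActionCategory.back b : V S) = v₀ S
      · left
        rw [← vtx_back S b, hb]; rfl
      · right
        exact ⟨vtx S (parent S _ hb), ⟨⟨parentArrow S _ hb, hb, rfl⟩⟩⟩)

/-- Tree arrows are true. [cite: LyndonSchupp2001, Ch. I Prop. 3.10] -/
theorem isTrue_of_mem_tree {a b : Symmetrify (Generators (Cov S))} {f : a ⟶ b} (hf : f ∈ tree S a b) :
    SymmArrowSat (IsTrue S) f := by
  obtain ⟨hb, h⟩ := hf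
  obtain ⟨rfl, h2⟩ := Sigma.mk.inj_iff.1 h
  rw [eq_of_heq h2]
  exact parentArrow_true S _ hb

/-- A generating arrow lying in the tree (in either direction) is true.
[cite: LyndonSchupp2001, Ch. I Prop. 3.10] -/
theorem isTrue_of_mem_treeArrows {a b : Generators (Cov S)} (e : a ⟶ b)
    (h : (⟨a, b, e⟩ : Total (Generators (Cov S))) ∈ treeArrows (tree S)) : IsTrue S e := by
  rcases (mem_treeArrows_iff (tree S) _).1 h with h | h
  · exact isTrue_of_mem_tree S h
  · exact isTrue_of_mem_tree S h

end

end FreeFactor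

end Literature.GroupTheory.CombinatorialGroupTheory
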